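import Summits.BirchSwinnertonDyer.BirchSwinnertonDyer.Theses.ByReductionTypeAtTwo
import Summits.BirchSwinnertonDyer.BirchSwinnertonDyer.Theorems.ByReductionTypeAtTwoRankOneAtTwoOneDoorLawDefs
import Summits.BirchSwinnertonDyer.BirchSwinnertonDyer.Theorems.ByReductionTypeAtTwoRankOneAtTwoOneDoorLawCDefs
import Summits.BirchSwinnertonDyer.BirchSwinnertonDyer.Theorems.ByReductionTypeAtTwoRankOneAtTwoBigImageOddLocalOneDoorFullC
import Summits.BirchSwinnertonDyer.BirchSwinnertonDyer.Theorems.ByReductionTypeAtTwoRankOneAtTwoBigImageOddLocalOneDoorAnalyticAssemblyC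
import Summits.BirchSwinnertonDyer.BirchSwinnertonDyer.Theorems.ByReductionTypeAtTwoRankOneAtTwoBigImageOddLocalOneDoorAnalyticGlue
import Summits.BirchSwinnertonDyer.BirchSwinnertonDyer.Theorems.ByReductionTypeAtTwoRankOneAtTwoBigImageOddLocalOneDoorValue
import Summits.BirchSwinnertonDyer.BirchSwinnertonDyer.Theorems.ByReductionTypeAtTwoRankOneAtTwoBigImageOddLocalOneDoorTamagawa
import Summits.BirchSwinnertonDyer.BirchSwinnertonDyer.Theorems.ByReductionTypeAtTwoRankOneAtTwoBigImageOddLocalOneDoorKolyvaginExactBridgeSupply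
import Summits.BirchSwinnertonDyer.BirchSwinnertonDyer.Theorems.CMKolyvaginAtInertTwoCMExactDescentAtTwoGeneral
import Summits.BirchSwinnertonDyer.BirchSwinnertonDyer.Theorems.GenusKolyvaginAtTwoCyclicTorsionOfNegDisc
import Literature.NumberTheory.EllipticCurves.TwoAdicImageNonSurjectiveFamiliesProofs
import Literature.NumberTheory.EllipticCurves.LocalTorsionMultiplicativeProofs
import Literature.NumberTheory.EllipticCurves.NonsplitProofs
import Literature.NumberTheory.EllipticCurves.NeronComponentIndexSplitProofs
import Literature.NumberTheory.Automorphic.ShimuraCurveRibetTakahashiComponentPackage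
import Summits.BirchSwinnertonDyer.Rank1Residual.X11b.BDPRouteRTDegreeTelescope
import HarnessLib
import Summits.BirchSwinnertonDyer.BirchSwinnertonDyer.Theorems.GenusKolyvaginAtTwoEquivariantChebotarevAtTwoStepB
import Summits.BirchSwinnertonDyer.BirchSwinnertonDyer.Theorems.ClassRecordThreeShimuraKolyvaginImageInputs
import Literature.NumberTheory.EllipticCurves.NonEisensteinPrimeOfSurjective

/-!
# RefinedKolyvaginEngineG6LocalN — §N of the g6 ENGINE QUARRY (separate workfile; the main quarry
`RefinedKolyvaginEngineG6.lean` is at the 200 kB workfile cap).  crux-plan g6, line `refined_kolyvagin_tamagawa_shift_at_two`,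
crux `RankOneAtTwoOffBigImageOddLocal` (route ByReductionTypeAtTwo).  PROVED, 0 sorry; self-contained (same 21 imports as the quarry;
does NOT import the quarry — Cruxes workfiles are copy-source, not modules).  Nothing here proves the crux, `BSDp W 2` or BSD.

## §N  LOCAL TRIVIALITY AT REGULAR KOLYVAGIN PRIMES (E4-β): `E(K̄)[2^{n+1}] = E(K_λ)[2^{n+1}]`

The regular analogues of the two Gross-notion lemmas every Euler-system local computation at `λ` starts from —
`exists_isArithFrobAt_mem_torsionFixing` (HeegnerPointsKolyvaginPrimaryRamifiedProofs) and
`absGaloisRestrict_smul_geomTorsion_eq_of_kolyvaginPrime(_pow)` (HeegnerPointsKolyvaginPrimaryLocalTrivialProofs; McCallum 1991 §4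
*"`λ` splits completely in `K(E[p^M])`"*) — with `FrobEqFrobInfty W K q ℓ` REPLACED by the regular Frobenius clause exported by the quarry's §K
(`∃ v 𝔓 h, (ℓ) ∈ v ∧ 𝔓 ∣ v ∧ IsArithFrobAt h 𝔓 ∧ (h = h₀ on E[m]) ∧ (h = c₀ on K)`, `h₀ = c₀ · res ρ`) plus the involution clause `h₀² = 1` on `E[m]`:
`Frob_λ = h²` FIXES `E[m]`, hence all of `Γ_{K_λ}` does (good reduction at `λ`, `λ ∤ m`).

* `exists_isArithFrobAt_mem_torsionFixing_regular` — at every `𝔔 ∣ λ` an arithmetic Frobenius `F ∈ Γ_K` with `F ∈ torsionFixing E_K[m]`.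
* `absGaloisRestrict_smul_geomTorsion_eq_regular` — `res_{K_λ/K} g • Q = Q` for all `g ∈ Γ_{K_λ}`, `Q ∈ E(K̄)[m]`.
* `hasGoodReductionAt_baseChange_of_rat`, `hasGoodReductionAt_of_not_dvd_conductorNorm` — the good-reduction dictionary (`ℓ ∤ N_E` ⇒ good at `w ∋ ℓ`).
* **`absGaloisRestrict_smul_geomTorsion_eq_of_regularKolyvaginPrime`** — packaged: hypotheses are exactly the clauses of the quarry's
  `exists_regular_kolyvaginPrime_of_heegner` output with `N := W.conductorNorm ℤ` (`ℓ.Prime`, `¬ ℓ ∣ N_E`, `ℓ ≠ 2`, `(ℓ)` prime in `𝓞 K`, Frobenius clause)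
  and its involution clause `hsq`; conclusion `E(K̄)[2^{n+1}] ⊆ E(K_λ)`.

* §N′ (v2): `exists_conj_mul_absGaloisRestrict_eq`, **`regularFrob_exists_at`** (the regular clause at EVERY `𝔓 ∣ ℓ`), `conj_clauses`
  (transfer of involution / `μ`-inversion / `2^n`-witness / lossless along conjugation), **`regularKolyvaginPrime_at`** (packaged: §K data at a prescribed `𝔓`).

* §N″ (v3): `antiLossless_of_lossless` (finite abelian group + additive involution: `ker(A-1) ⊆ im(A+1) ⇒ ker(A+1) ⊆ im(A-1)`, by counting),
  **`antiLossless_geomTorsion`** (graded Galois-level anti-lossless for any `h₀ ∈ Γ_ℚ` from §K's `hsq` + `hker`).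

What this is for (card §E4): the Euler-system consumers at level `2^{M}` take `hℓM : FrobEqFrobInfty W K (2^M) ℓ`, which NO regular prime satisfies for
`M ≥ 2`; group (β) of those consumers only uses it through these two lemmas, which are now available for regular primes verbatim.

Refs: [McCallumLMS1991] §4; [GrossLMS1991] §3 (3.1)–(3.2); [NeukirchANT1999] I (8.2), II (9.6); [SilvermanAEC2009] VII.4.1, VII.5.1.
-/

set_option autoImplicit false

noncomputable section

open scoped Classical Pointwise

namespace Summit.BirchSwinnertonDyer.BirchSwinnertonDyer.Cruxes.RankOneAtTwoOffBigImageOddLocal.RefinedKolyvaginTamagawaShiftAtTwo.EngineG6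

open _root_.WeierstrassCurve NumberField IsDedekindDomain Field Function
open Literature.NumberTheory.GaloisRepresentations Literature.NumberTheory.EllipticCurves Literature.NumberTheory

section LocalTrivialityN

universe u

variable (W : WeierstrassCurve ℚ) {K : Type u} [Field K] [NumberField K]

/-- **Regular analogue of `exists_isArithFrobAt_mem_torsionFixing`** (McCallum §4 / Gross (3.2) at a REGULAR Kolyvagin prime):
`K` imaginary quadratic, `ℓ` inert in `K`, `h₀ ∈ Γ_ℚ` with `h₀² = 1` on `E(ℚ̄)[m]`, and a Frobenius `h` at a prime above `ℓ` acting as `h₀`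
on `E[m]` and as the complex conjugation `c₀` on `K`; then at every prime `𝔔 ∣ λ = (ℓ)` of `\bar ℤ_K` there is an arithmetic Frobenius
`F ∈ Γ_K` fixing `E(K̄)[m]` (`res F = h² = h₀² = 1` on `E[m]`). -/
theorem exists_isArithFrobAt_mem_torsionFixing_regular [W.IsElliptic] (hK : IsImaginaryQuadratic K)
    {m : ℕ} [NeZero m] {c₀ : absoluteGaloisGroup ℚ} (hc₀ : IsComplexConjugation (Rat.castHom ℝ) c₀)
    {h₀ : absoluteGaloisGroup ℚ} (hsq : ∀ P : geomTorsion W (m : ℤ), h₀ • h₀ • P = P)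
    {ℓ : ℕ} (hℓ : ℓ.Prime) (hinert : (Ideal.span {(ℓ : 𝓞 K)}).IsPrime)
    (hfrob : ∃ (v : HeightOneSpectrum (𝓞 ℚ)) (𝔓 : Ideal (absIntegers (𝓞 ℚ) ℚ)) (h : absoluteGaloisGroup ℚ),
      (ℓ : 𝓞 ℚ) ∈ v.asIdeal ∧ 𝔓 ∈ v.primesAbove ∧ IsArithFrobAt (𝓞 ℚ) h 𝔓 ∧
      (∀ P : geomTorsion W (m : ℤ), h • P = h₀ • P) ∧
      ∀ (e : K →ₐ[ℚ] AlgebraicClosure ℚ) (x : K), h • e x = c₀ • e x)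
    {w : HeightOneSpectrum (𝓞 K)} (hℓw : (ℓ : 𝓞 K) ∈ w.asIdeal)
    {𝔔 : Ideal (absIntegers (𝓞 K) K)} (h𝔔 : 𝔔 ∈ w.primesAbove) :
    ∃ F : absoluteGaloisGroup K, IsArithFrobAt (𝓞 K) F 𝔔 ∧
      F ∈ torsionFixing (W.baseChange K) (m : ℤ) := by
  classical
  haveI : Algebra.IsQuadraticExtension ℚ K := ⟨hK.1⟩
  haveI : IsTotallyComplex K := hK.2
  obtain ⟨v, 𝔓₀, h, hℓv, h𝔓₀, hh, hE, hKact⟩ := hfrob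
  have hHi := index_range_absGaloisRestrict_eq_finrank ℚ K
  haveI hHn : ((absGaloisRestrict ℚ K).range).Normal :=
    Subgroup.normal_of_index_eq_two (hHi.trans hK.1)
  set e₀ : K →ₐ[ℚ] AlgebraicClosure ℚ :=
    (Literature.NumberTheory.EllipticCurves.absClosureEquiv ℚ K).symm.toAlgHom.comp
      (IsScalarTower.toAlgHom ℚ K (AlgebraicClosure K)) with he₀
  have he₀x : ∀ x : K, e₀ x = (Literature.NumberTheory.EllipticCurves.absClosureEquiv ℚ K).symm (algebraMap K (AlgebraicClosure K) x) :=
    fun _ ↦ rfl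
  have hrange : ∀ γ : absoluteGaloisGroup ℚ,
      γ ∈ Set.range (absGaloisRestrict ℚ K) ↔ ∀ x : K, γ • e₀ x = e₀ x := fun γ ↦ by
    rw [mem_range_absGaloisRestrict_iff]
    refine forall_congr' fun x ↦ ?_
    rw [absGaloisTransport_apply, he₀x]
    constructor
    · intro h1
      apply (Literature.NumberTheory.EllipticCurves.absClosureEquiv ℚ K).injective
      rw [AlgEquiv.apply_symm_apply]
      exact h1
    · intro h1
      rw [h1, AlgEquiv.apply_symm_apply]
  have hc₀H : c₀ ∉ Set.range (absGaloisRestrict ℚ K) :=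
    hc₀.not_mem_range_absGaloisRestrict (L := K) IsTotallyComplex.isComplex
  have hhH : h ∉ (absGaloisRestrict ℚ K).range := by
    intro hmem
    have hmem' : h ∈ Set.range (absGaloisRestrict ℚ K) := hmem
    apply hc₀H
    rw [hrange]
    intro x
    rw [← hKact e₀ x]
    exact (hrange h).mp hmem' x
  -- `ℓ` unramified in `K`; a Frobenius `τ'` above `λ` with `res τ' = h²`
  have hunr : Algebra.IsUnramifiedIn (𝓞 K) v.asIdeal :=
    isUnramifiedIn_of_span_natCast_isPrime hℓ hinert hℓv
  have hIr := inertia_le_range_absGaloisRestrict_of_isUnramifiedIn (K := K) hunr h𝔓₀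
  obtain ⟨w', 𝔔₁, τ', hw'v, hwuniq, -, h𝔔₁w, -, hτ', hresτ'⟩ :=
    exists_place_inert_of_not_mem_range (F := ℚ) (M := K) (hK.1 ▸ Nat.prime_two) hHn
      (hHi.trans rfl) hunr h𝔓₀ hIr hh hhH
  have hww' : w = w' := by
    apply hwuniq
    apply HeightOneSpectrum.eq_of_natCast_mem_rat hℓ _ hℓv
    rw [HeightOneSpectrum.under_asIdeal, Ideal.under_def, Ideal.mem_comap, map_natCast]
    exact hℓw
  rw [hK.1] at hresτ'
  -- `τ'` fixes `E(K̄)[m]`: `res τ' = h²` acts as `h₀² = 1`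
  have hτ'fix : τ' ∈ torsionFixing (W.baseChange K) (m : ℤ) := by
    rw [mem_torsionFixing_iff]
    intro Q
    obtain ⟨P, rfl⟩ := (RatClosure.torsionEquiv (K := K) W (m : ℤ)).surjective Q
    rw [← RatClosure.torsionEquiv_smul W (m : ℤ) τ' P, hresτ', pow_two, mul_smul, hE, hE, hsq]
  -- conjugate `τ'` to the prescribed prime `𝔔 ∣ λ`
  rw [← hww'] at h𝔔₁w
  obtain ⟨δ, -, hF⟩ :=
    HeightOneSpectrum.exists_isArithFrobAt_conj_of_mem_primesAbove_holds h𝔔₁w h𝔔 hτ'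
  exact ⟨δ * τ' * δ⁻¹, hF, (torsionFixing_normal (W.baseChange K) (m : ℤ)).conj_mem _ hτ'fix δ⟩

/-- **Regular analogue of `absGaloisRestrict_smul_geomTorsion_eq_of_kolyvaginPrime(_pow)`** (McCallum §4: *"`λ` splits completely in `K(E[m])`"*):
under the hypotheses of `exists_isArithFrobAt_mem_torsionFixing_regular`, with `E/K` of good reduction at `λ = w` and `λ ∤ m`, the whole local
Galois group `Γ_{K_λ}` acts trivially on `E(K̄)[m]`, i.e. `E(K̄)[m] = E(K_λ)[m]`. -/
theorem absGaloisRestrict_smul_geomTorsion_eq_regular [W.IsElliptic] (hK : IsImaginaryQuadratic K)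
    {m : ℕ} [NeZero m] {c₀ : absoluteGaloisGroup ℚ} (hc₀ : IsComplexConjugation (Rat.castHom ℝ) c₀)
    {h₀ : absoluteGaloisGroup ℚ} (hsq : ∀ P : geomTorsion W (m : ℤ), h₀ • h₀ • P = P)
    {ℓ : ℕ} (hℓ : ℓ.Prime) (hinert : (Ideal.span {(ℓ : 𝓞 K)}).IsPrime)
    (hfrob : ∃ (v : HeightOneSpectrum (𝓞 ℚ)) (𝔓 : Ideal (absIntegers (𝓞 ℚ) ℚ)) (h : absoluteGaloisGroup ℚ),
      (ℓ : 𝓞 ℚ) ∈ v.asIdeal ∧ 𝔓 ∈ v.primesAbove ∧ IsArithFrobAt (𝓞 ℚ) h 𝔓 ∧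
      (∀ P : geomTorsion W (m : ℤ), h • P = h₀ • P) ∧
      ∀ (e : K →ₐ[ℚ] AlgebraicClosure ℚ) (x : K), h • e x = c₀ • e x)
    {w : HeightOneSpectrum (𝓞 K)} (hℓw : (ℓ : 𝓞 K) ∈ w.asIdeal)
    (hgood : (W.baseChange K).HasGoodReductionAt w) (hmw : (((m : ℕ) : ℤ) : 𝓞 K) ∉ w.asIdeal)
    (g : absoluteGaloisGroup (w.adicCompletion K)) (Q : geomTorsion (W.baseChange K) (m : ℤ)) :
    absGaloisRestrict K (w.adicCompletion K) g • Q = Q := by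
  have hq0 : ((m : ℕ) : ℤ) ≠ 0 := Int.natCast_ne_zero.mpr (NeZero.ne m)
  have h𝔓₀ : adicCompletionPrime K w ∈ w.primesAbove := adicCompletionPrime_mem_primesAbove K w
  obtain ⟨F, hF, hFfix⟩ := exists_isArithFrobAt_mem_torsionFixing_regular W hK hc₀ hsq hℓ hinert hfrob hℓw h𝔓₀
  have hDeq := decompositionSubgroup_adicCompletionPrime_eq_range K w
  have hI₀ : (adicCompletionPrime K w).inertia (absoluteGaloisGroup K) ≤
      torsionFixing (W.baseChange K) (m : ℤ) := fun τ hτ =>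
    (mem_torsionFixing_iff _ _).mpr fun Q' =>
      (W.baseChange K).smul_geomTorsion_eq_of_mem_inertia hgood hmw h𝔓₀ hτ Q'
  have hd : absGaloisRestrict K (w.adicCompletion K) g ∈
      (adicCompletionPrime K w).decompositionSubgroup (absoluteGaloisGroup K) := by
    rw [hDeq]; exact ⟨g, rfl⟩
  obtain ⟨k, i, u, hi, hu, hdeq⟩ := exists_eq_frobenius_pow_mul_of_mem_decompositionSubgroup
    h𝔓₀ hF (isOpen_torsionFixing (W.baseChange K) hq0) hd
  have hmem : absGaloisRestrict K (w.adicCompletion K) g ∈ torsionFixing (W.baseChange K) (m : ℤ) := by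
    rw [hdeq]
    exact Subgroup.mul_mem _ (Subgroup.mul_mem _ (Subgroup.pow_mem _ hFfix k) (hI₀ hi)) hu
  exact smul_eq_of_mem_torsionFixing _ _ hmem Q

/-- Good reduction of `E/K` at a place `w ∋ ℓ` from good reduction of `E/ℚ` at the rational place below. -/
theorem hasGoodReductionAt_baseChange_of_rat [W.IsElliptic] {ℓ : ℕ} (hℓ : ℓ.Prime)
    {v : HeightOneSpectrum (𝓞 ℚ)} (hℓv : (ℓ : 𝓞 ℚ) ∈ v.asIdeal) (hgood : W.HasGoodReductionAt v)
    {w : HeightOneSpectrum (𝓞 K)} (hℓw : (ℓ : 𝓞 K) ∈ w.asIdeal) :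
    (W.baseChange K).HasGoodReductionAt w := by
  have hwv : w.under (𝓞 ℚ) = v := by
    apply HeightOneSpectrum.eq_of_natCast_mem_rat hℓ _ hℓv
    rw [HeightOneSpectrum.under_asIdeal, Ideal.under_def, Ideal.mem_comap, map_natCast]
    exact hℓw
  haveI : w.asIdeal.LiesOver v.asIdeal := ⟨by rw [← hwv]; rfl⟩
  exact hasGoodReductionAt_baseChange_of_hasGoodReductionAt_rat W v w hgood

/-- `ℓ ∤ N_E` ⇒ good reduction of `E/ℚ` at the place `v ∋ ℓ` (conductor criterion + the prime/place dictionary). -/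
theorem hasGoodReductionAt_of_not_dvd_conductorNorm [W.IsElliptic] {ℓ : ℕ} (hℓ : ℓ.Prime)
    {v : HeightOneSpectrum (𝓞 ℚ)} (hℓv : (ℓ : 𝓞 ℚ) ∈ v.asIdeal) (hN : ¬ ℓ ∣ W.conductorNorm ℤ) :
    W.HasGoodReductionAt v := by
  have hv : (Rat.HeightOneSpectrum.primesEquiv v : ℕ) = ℓ :=
    (Nat.prime_dvd_prime_iff_eq (Rat.HeightOneSpectrum.primesEquiv v).2 hℓ).mp
      ((Literature.NumberTheory.EllipticCurves.DeuringLadic.natCast_mem_asIdeal_iff v ℓ).mp hℓv)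
  haveI : Fact (Rat.HeightOneSpectrum.primesEquiv v : ℕ).Prime := ⟨(Rat.HeightOneSpectrum.primesEquiv v).2⟩
  have h := hasGoodReductionAtPrime_of_not_dvd_conductorNorm W
    (ℓ := (Rat.HeightOneSpectrum.primesEquiv v : ℕ)) (by rw [hv]; exact hN)
  exact (WeierstrassCurve.hasGoodReductionAtPrime_iff_hasGoodReductionAt_ringOfIntegers v W).mp h

/-- **Packaged for the §K/§M regular Kolyvagin primes**: `Γ_{K_λ}` fixes `E(K̄)[2^{n+1}]` at every regular Kolyvagin prime `ℓ ∤ N_E` produced by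
`exists_regular_kolyvaginPrime_of_heegner` (its clauses `ℓ.Prime`, `¬ ℓ ∣ W.conductorNorm ℤ`, `ℓ ≠ 2`, `(ℓ)` prime in `𝓞 K`, the Frobenius clause, and
the involution clause `hsq` of `h = c₀ · res ρ`). -/
theorem absGaloisRestrict_smul_geomTorsion_eq_of_regularKolyvaginPrime [W.IsElliptic] (hK : IsImaginaryQuadratic K)
    (n : ℕ) {c₀ : absoluteGaloisGroup ℚ} (hc₀ : IsComplexConjugation (Rat.castHom ℝ) c₀) {ρ : absoluteGaloisGroup K}
    (hsq : ∀ X : geomTorsion W ((2 ^ (n + 1) : ℕ) : ℤ),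
      (c₀ * absGaloisRestrict ℚ K ρ) • (c₀ * absGaloisRestrict ℚ K ρ) • X = X)
    {ℓ : ℕ} (hℓ : ℓ.Prime) (hN : ¬ ℓ ∣ W.conductorNorm ℤ) (hℓ2 : ℓ ≠ 2) (hinert : (Ideal.span {(ℓ : 𝓞 K)}).IsPrime)
    (hfrob : ∃ (v : HeightOneSpectrum (𝓞 ℚ)) (𝔓 : Ideal (absIntegers (𝓞 ℚ) ℚ)) (h : absoluteGaloisGroup ℚ),
      (ℓ : 𝓞 ℚ) ∈ v.asIdeal ∧ 𝔓 ∈ v.primesAbove ∧ IsArithFrobAt (𝓞 ℚ) h 𝔓 ∧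
      (∀ P : geomTorsion W ((2 ^ (n + 1) : ℕ) : ℤ), h • P = (c₀ * absGaloisRestrict ℚ K ρ) • P) ∧
      ∀ (e : K →ₐ[ℚ] AlgebraicClosure ℚ) (x : K), h • e x = c₀ • e x)
    {w : HeightOneSpectrum (𝓞 K)} (hℓw : (ℓ : 𝓞 K) ∈ w.asIdeal)
    (g : absoluteGaloisGroup (w.adicCompletion K)) (Q : geomTorsion (W.baseChange K) ((2 ^ (n + 1) : ℕ) : ℤ)) :
    absGaloisRestrict K (w.adicCompletion K) g • Q = Q := by
  haveI : NeZero (2 ^ (n + 1)) := ⟨pow_ne_zero _ two_ne_zero⟩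
  obtain ⟨v, 𝔓, h, hℓv, h𝔓, hh, hE, hKact⟩ := hfrob
  have hgood : (W.baseChange K).HasGoodReductionAt w :=
    hasGoodReductionAt_baseChange_of_rat W hℓ hℓv (hasGoodReductionAt_of_not_dvd_conductorNorm W hℓ hℓv hN) hℓw
  have h2w : ((2 : ℕ) : 𝓞 K) ∉ w.asIdeal := not_natCast_mem_of_prime_ne hℓ Nat.prime_two hℓ2 w hℓw
  have hmw : ((((2 ^ (n + 1) : ℕ) : ℤ)) : 𝓞 K) ∉ w.asIdeal := fun hm ↦ by
    apply h2w
    rw [Int.cast_natCast, Nat.cast_pow] at hm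
    exact w.isPrime.mem_of_pow_mem _ hm
  exact absGaloisRestrict_smul_geomTorsion_eq_regular W hK hc₀ hsq hℓ hinert ⟨v, 𝔓, h, hℓv, h𝔓, hh, hE, hKact⟩ hℓw
    hgood hmw g Q

end LocalTrivialityN

/-! ## §N′  THE REGULAR FROBENIUS CLAUSE AT EVERY PRIME ABOVE `ℓ` (regular `FrobEqFrobInfty.exists_at`, PROVED)

Gross's (3.2) is a statement about a conjugacy class; so is the regular clause: conjugating `h`, `c₀` AND `ρ` simultaneously by `γ ∈ Γ_ℚ`
with `γ 𝔓₀ = 𝔓` moves the Frobenius to any prescribed `𝔓 ∣ ℓ`, replaces `c₀` by the complex conjugation `γ c₀ γ⁻¹` and `ρ` by some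
`ρ' ∈ Γ_K` (`res Γ_K ⊴ Γ_ℚ`), and the four `E[m]` / `μ_m` clauses of §J/§K transfer along `P ↦ γ • P`.  (Consumers that fixed ONE
global `c₀` for the `τ`-eigenspace decomposition are unaffected: `conjAct` is lift-independent, `IsLiftOfAut.conjH1_eq_conjAct`.) -/

section PrescribedPrimeN

universe u'

variable (W : WeierstrassCurve ℚ) {K : Type u'} [Field K] [NumberField K]

/-- Conjugation inside `Γ_ℚ` of an element of the form `c₀ · res ρ` (`ρ ∈ Γ_K`) is again of that form, with the conjugate `c₀`:
`γ (c₀ · res ρ) γ⁻¹ = (γ c₀ γ⁻¹) · res ρ'` (normality of `res Γ_K ⊴ Γ_ℚ`, index `2`). -/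
theorem exists_conj_mul_absGaloisRestrict_eq (hK : IsImaginaryQuadratic K) (c₀ γ : absoluteGaloisGroup ℚ)
    (ρ : absoluteGaloisGroup K) :
    ∃ ρ' : absoluteGaloisGroup K, γ * (c₀ * absGaloisRestrict ℚ K ρ) * γ⁻¹ = (γ * c₀ * γ⁻¹) * absGaloisRestrict ℚ K ρ' := by
  haveI : Algebra.IsQuadraticExtension ℚ K := ⟨hK.1⟩
  have hHi := index_range_absGaloisRestrict_eq_finrank ℚ K
  haveI hHn : ((absGaloisRestrict ℚ K).range).Normal :=
    Subgroup.normal_of_index_eq_two (hHi.trans hK.1)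
  obtain ⟨ρ', hρ'⟩ : γ * absGaloisRestrict ℚ K ρ * γ⁻¹ ∈ (absGaloisRestrict ℚ K).range :=
    hHn.conj_mem _ ⟨ρ, rfl⟩ γ
  refine ⟨ρ', ?_⟩
  have hρ'' : absGaloisRestrict ℚ K ρ' = γ * absGaloisRestrict ℚ K ρ * γ⁻¹ := hρ'
  rw [hρ'']; group

/-- **The regular Frobenius clause holds at EVERY prime above `ℓ`** (regular analogue of `FrobEqFrobInfty.exists_at`, Gross (3.2)):
conjugate `h`, `c₀` and `ρ` simultaneously by `γ ∈ Γ_ℚ` with `γ 𝔓₀ = 𝔓`.  The complex conjugation changes to its conjugate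
`γ c₀ γ⁻¹` (still a complex conjugation, `IsComplexConjugation.conj_mul`) and `ρ` to some `ρ' ∈ Γ_K`; the involution / `μ`-inversion /
lossless clauses transfer along `P ↦ γ • P` (`conj_clauses` below). -/
theorem regularFrob_exists_at [W.IsElliptic] (hK : IsImaginaryQuadratic K) {m : ℕ}
    {c₀ : absoluteGaloisGroup ℚ} (hc₀ : IsComplexConjugation (Rat.castHom ℝ) c₀) {ρ : absoluteGaloisGroup K}
    {ℓ : ℕ} (hℓ : ℓ.Prime)
    (hfrob : ∃ (v : HeightOneSpectrum (𝓞 ℚ)) (𝔓 : Ideal (absIntegers (𝓞 ℚ) ℚ)) (h : absoluteGaloisGroup ℚ),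
      (ℓ : 𝓞 ℚ) ∈ v.asIdeal ∧ 𝔓 ∈ v.primesAbove ∧ IsArithFrobAt (𝓞 ℚ) h 𝔓 ∧
      (∀ P : geomTorsion W (m : ℤ), h • P = (c₀ * absGaloisRestrict ℚ K ρ) • P) ∧
      ∀ (e : K →ₐ[ℚ] AlgebraicClosure ℚ) (x : K), h • e x = c₀ • e x)
    {v : HeightOneSpectrum (𝓞 ℚ)} (hℓv : (ℓ : 𝓞 ℚ) ∈ v.asIdeal)
    {𝔓 : Ideal (absIntegers (𝓞 ℚ) ℚ)} (h𝔓 : 𝔓 ∈ v.primesAbove) :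
    ∃ (γ h : absoluteGaloisGroup ℚ) (ρ' : absoluteGaloisGroup K), IsArithFrobAt (𝓞 ℚ) h 𝔓 ∧
      IsComplexConjugation (Rat.castHom ℝ) (γ * c₀ * γ⁻¹) ∧
      γ * (c₀ * absGaloisRestrict ℚ K ρ) * γ⁻¹ = (γ * c₀ * γ⁻¹) * absGaloisRestrict ℚ K ρ' ∧
      (∀ P : geomTorsion W (m : ℤ), h • P = ((γ * c₀ * γ⁻¹) * absGaloisRestrict ℚ K ρ') • P) ∧
      ∀ (e : K →ₐ[ℚ] AlgebraicClosure ℚ) (x : K), h • e x = (γ * c₀ * γ⁻¹) • e x := by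
  obtain ⟨v₀, 𝔓₀, h, hℓv₀, h𝔓₀, hFrob, hhP, hhK⟩ := hfrob
  have hv : v₀ = v := HeightOneSpectrum.eq_of_natCast_mem_rat hℓ hℓv₀ hℓv
  subst hv
  obtain ⟨γ, -, hFrob'⟩ :=
    HeightOneSpectrum.exists_isArithFrobAt_conj_of_mem_primesAbove_holds h𝔓₀ h𝔓 hFrob
  obtain ⟨ρ', hρ'⟩ := exists_conj_mul_absGaloisRestrict_eq hK c₀ γ ρ
  refine ⟨γ, γ * h * γ⁻¹, ρ', hFrob', hc₀.conj_mul γ, hρ', fun P ↦ ?_, fun e x ↦ ?_⟩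
  · rw [← hρ', mul_smul, mul_smul, hhP, ← mul_smul, ← mul_smul]
  · set e' : K →ₐ[ℚ] AlgebraicClosure ℚ :=
      ((show AlgebraicClosure ℚ ≃ₐ[ℚ] AlgebraicClosure ℚ from γ⁻¹) :
        AlgebraicClosure ℚ →ₐ[ℚ] AlgebraicClosure ℚ).comp e with he'
    have hx : γ⁻¹ • e x = e' x := rfl
    rw [mul_smul, mul_smul, hx, hhK e', ← hx, ← mul_smul, ← mul_smul]

/-- Transfer of the three `E[m]`-clauses (involution, a lossless-type witness, lossless) and the `μ_m`-inversion along conjugation by `γ`. -/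
theorem conj_clauses [W.IsElliptic] {m n : ℕ} (h₀ γ : absoluteGaloisGroup ℚ)
    (hsq : ∀ P : geomTorsion W (m : ℤ), h₀ • h₀ • P = P)
    (hμ : ∀ ζ : AlgebraicClosure ℚ, ζ ^ m = 1 → h₀ • ζ = ζ⁻¹)
    (hP1 : ∃ P : geomTorsion W (m : ℤ), (2 : ℤ) ^ n • (P + h₀ • P) ≠ 0)
    (hker : ∀ (k : ℕ) (X : geomTorsion W (m : ℤ)), (2 : ℤ) ^ k • X = 0 → h₀ • X = X →
      ∃ Y : geomTorsion W (m : ℤ), (2 : ℤ) ^ k • Y = 0 ∧ X = Y + h₀ • Y) :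
    (∀ P : geomTorsion W (m : ℤ), (γ * h₀ * γ⁻¹) • (γ * h₀ * γ⁻¹) • P = P) ∧
    (∀ ζ : AlgebraicClosure ℚ, ζ ^ m = 1 → (γ * h₀ * γ⁻¹) • ζ = ζ⁻¹) ∧
    (∃ P : geomTorsion W (m : ℤ), (2 : ℤ) ^ n • (P + (γ * h₀ * γ⁻¹) • P) ≠ 0) ∧
    (∀ (k : ℕ) (X : geomTorsion W (m : ℤ)), (2 : ℤ) ^ k • X = 0 → (γ * h₀ * γ⁻¹) • X = X →
      ∃ Y : geomTorsion W (m : ℤ), (2 : ℤ) ^ k • Y = 0 ∧ X = Y + (γ * h₀ * γ⁻¹) • Y) := by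
  have hconj : ∀ Z : geomTorsion W (m : ℤ), (γ * h₀ * γ⁻¹) • γ • Z = γ • h₀ • Z := fun Z ↦ by
    rw [mul_smul, mul_smul, inv_smul_smul]
  refine ⟨fun P ↦ ?_, fun ζ hζ ↦ ?_, ?_, fun k X hk hX ↦ ?_⟩
  · rw [mul_smul, mul_smul, mul_smul, mul_smul, inv_smul_smul, hsq, smul_inv_smul]
  · have hζ' : (γ⁻¹ • ζ) ^ m = 1 := by rw [← smul_pow', hζ, smul_one]
    rw [mul_smul, mul_smul, hμ _ hζ', smul_inv'', smul_inv_smul]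
  · obtain ⟨P, hP⟩ := hP1
    refine ⟨γ • P, fun h0 ↦ hP ?_⟩
    rw [hconj, ← smul_add, smul_comm ((2 : ℤ) ^ n) γ, smul_eq_zero_iff_eq] at h0
    exact h0
  · have hk' : (2 : ℤ) ^ k • γ⁻¹ • X = 0 := by rw [smul_comm, hk, smul_zero]
    have h1 : h₀ • γ⁻¹ • X = γ⁻¹ • X := by
      conv_rhs => rw [← hX]
      rw [mul_smul, mul_smul, inv_smul_smul]
    obtain ⟨Y, hY, hXY⟩ := hker k (γ⁻¹ • X) hk' h1
    refine ⟨γ • Y, by rw [smul_comm, hY, smul_zero], ?_⟩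
    rw [hconj, ← smul_add, ← hXY, smul_inv_smul]

/-- **PACKAGED: the §K data at a PRESCRIBED prime `𝔓 ∣ ℓ` of `\bar ℤ`.**  From the clauses of `exists_regular_kolyvaginPrime_of_heegner` for
`h₀ = c₀ · res ρ` (involution on `E[m]`, `μ_m`-inversion, the `2^n`-witness, lossless) and its Frobenius clause at SOME prime above `ℓ`, obtain —
at ANY `𝔓 ∣ ℓ` — a complex conjugation `c₀'`, `ρ' ∈ Γ_K` and an arithmetic Frobenius `h` AT `𝔓` with `h = c₀' · res ρ'` on `E[m]`, `h = c₀'` on `K`,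
and all four clauses for `c₀' · res ρ'`. -/
theorem regularKolyvaginPrime_at [W.IsElliptic] (hK : IsImaginaryQuadratic K) {m n : ℕ}
    {c₀ : absoluteGaloisGroup ℚ} (hc₀ : IsComplexConjugation (Rat.castHom ℝ) c₀) {ρ : absoluteGaloisGroup K}
    (hsq : ∀ P : geomTorsion W (m : ℤ), (c₀ * absGaloisRestrict ℚ K ρ) • (c₀ * absGaloisRestrict ℚ K ρ) • P = P)
    (hμ : ∀ ζ : AlgebraicClosure ℚ, ζ ^ m = 1 → (c₀ * absGaloisRestrict ℚ K ρ) • ζ = ζ⁻¹)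
    (hP1 : ∃ P : geomTorsion W (m : ℤ), (2 : ℤ) ^ n • (P + (c₀ * absGaloisRestrict ℚ K ρ) • P) ≠ 0)
    (hker : ∀ (k : ℕ) (X : geomTorsion W (m : ℤ)), (2 : ℤ) ^ k • X = 0 → (c₀ * absGaloisRestrict ℚ K ρ) • X = X →
      ∃ Y : geomTorsion W (m : ℤ), (2 : ℤ) ^ k • Y = 0 ∧ X = Y + (c₀ * absGaloisRestrict ℚ K ρ) • Y)
    {ℓ : ℕ} (hℓ : ℓ.Prime)
    (hfrob : ∃ (v : HeightOneSpectrum (𝓞 ℚ)) (𝔓 : Ideal (absIntegers (𝓞 ℚ) ℚ)) (h : absoluteGaloisGroup ℚ),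
      (ℓ : 𝓞 ℚ) ∈ v.asIdeal ∧ 𝔓 ∈ v.primesAbove ∧ IsArithFrobAt (𝓞 ℚ) h 𝔓 ∧
      (∀ P : geomTorsion W (m : ℤ), h • P = (c₀ * absGaloisRestrict ℚ K ρ) • P) ∧
      ∀ (e : K →ₐ[ℚ] AlgebraicClosure ℚ) (x : K), h • e x = c₀ • e x)
    {v : HeightOneSpectrum (𝓞 ℚ)} (hℓv : (ℓ : 𝓞 ℚ) ∈ v.asIdeal)
    {𝔓 : Ideal (absIntegers (𝓞 ℚ) ℚ)} (h𝔓 : 𝔓 ∈ v.primesAbove) :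
    ∃ (c₀' h : absoluteGaloisGroup ℚ) (ρ' : absoluteGaloisGroup K),
      IsComplexConjugation (Rat.castHom ℝ) c₀' ∧ IsArithFrobAt (𝓞 ℚ) h 𝔓 ∧
      (∀ P : geomTorsion W (m : ℤ), h • P = (c₀' * absGaloisRestrict ℚ K ρ') • P) ∧
      (∀ (e : K →ₐ[ℚ] AlgebraicClosure ℚ) (x : K), h • e x = c₀' • e x) ∧
      (∀ P : geomTorsion W (m : ℤ), (c₀' * absGaloisRestrict ℚ K ρ') • (c₀' * absGaloisRestrict ℚ K ρ') • P = P) ∧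
      (∀ ζ : AlgebraicClosure ℚ, ζ ^ m = 1 → (c₀' * absGaloisRestrict ℚ K ρ') • ζ = ζ⁻¹) ∧
      (∃ P : geomTorsion W (m : ℤ), (2 : ℤ) ^ n • (P + (c₀' * absGaloisRestrict ℚ K ρ') • P) ≠ 0) ∧
      (∀ (k : ℕ) (X : geomTorsion W (m : ℤ)), (2 : ℤ) ^ k • X = 0 → (c₀' * absGaloisRestrict ℚ K ρ') • X = X →
        ∃ Y : geomTorsion W (m : ℤ), (2 : ℤ) ^ k • Y = 0 ∧ X = Y + (c₀' * absGaloisRestrict ℚ K ρ') • Y) := by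
  obtain ⟨γ, h, ρ', hFrob, hc₀', hρ', hhP, hhK⟩ := regularFrob_exists_at W hK hc₀ hℓ hfrob hℓv h𝔓
  obtain ⟨h1, h2, h3, h4⟩ := conj_clauses W (n := n) (c₀ * absGaloisRestrict ℚ K ρ) γ hsq hμ hP1 hker
  rw [hρ'] at h1 h2 h3 h4
  exact ⟨γ * c₀ * γ⁻¹, h, ρ', hc₀', hFrob, hhP, hhK, h1, h2, h3, h4⟩

end PrescribedPrimeN

/-! ## §N″  ANTI-LOSSLESS AT THE GALOIS LEVEL (PROVED): `ker(h₀ + 1) = im(h₀ - 1)` on every `E[m][2^k]`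

§J proves `Ĥ⁰(⟨h⟩, E[2^M]) = 0` (lossless) AND `Ĥ⁻¹ = 0` (anti-lossless, v13) for the MATRIX `reg b`; §K exports only the lossless
clause for the Galois element `h₀ = c₀ · res ρ`.  Rather than re-thread a fifth clause through §J → §H → §K, the anti-lossless clause is
derived here from the exported ones by the finite counting identity `|im(A+1)|·|ker(A+1)| = |T| = |im(A-1)|·|ker(A-1)|` — so
`(ε = -1)`-eigen-consumers (McCallum's `τ = -1` part) get their clause from §K's output with no change to the quarry. -/

section AntiLosslessN

variable (W : WeierstrassCurve ℚ)

/-- **Anti-lossless from lossless (finite modules with involution).**  For an additive involution `A` of a finite abelian group,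
`ker(A - 1) ⊆ im(A + 1)` implies `ker(A + 1) ⊆ im(A - 1)` (both cohomology groups of the cyclic group `⟨A⟩` vanish together:
`|im(A+1)|·|ker(A+1)| = |T| = |im(A-1)|·|ker(A-1)|`). -/
theorem antiLossless_of_lossless {T : Type*} [AddCommGroup T] [Finite T] (A : T →+ T) (hA : ∀ x, A (A x) = x)
    (hloss : ∀ x, A x = x → ∃ y, x = y + A y) : ∀ x, A x = -x → ∃ y, x = y - A y := by
  set fp : T →+ T := A + AddMonoidHom.id T with hfp
  set fm : T →+ T := A - AddMonoidHom.id T with hfm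
  have hfp_apply : ∀ y, fp y = A y + y := fun y ↦ rfl
  have hfm_apply : ∀ y, fm y = A y - y := fun y ↦ rfl
  -- `im fp = ker fm` (lossless + `(A-1)(A+1) = 0`) and `im fm ≤ ker fp`
  have h1 : fp.range = fm.ker := by
    apply le_antisymm
    · rintro _ ⟨y, rfl⟩
      rw [AddMonoidHom.mem_ker, hfm_apply, hfp_apply, map_add, hA]; abel
    · intro x hx
      rw [AddMonoidHom.mem_ker, hfm_apply, sub_eq_zero] at hx
      obtain ⟨y, hy⟩ := hloss x hx
      exact ⟨y, by rw [hfp_apply, hy, add_comm]⟩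
  have h2 : fm.range ≤ fp.ker := by
    rintro _ ⟨y, rfl⟩
    rw [AddMonoidHom.mem_ker, hfp_apply, hfm_apply, map_sub, hA]; abel
  -- cardinalities
  have hcp : Nat.card T = Nat.card fp.range * Nat.card fp.ker := by
    rw [AddSubgroup.card_eq_card_quotient_mul_card_addSubgroup fp.ker,
      Nat.card_congr (QuotientAddGroup.quotientKerEquivRange fp).toEquiv]
  have hcm : Nat.card T = Nat.card fm.range * Nat.card fm.ker := by
    rw [AddSubgroup.card_eq_card_quotient_mul_card_addSubgroup fm.ker,
      Nat.card_congr (QuotientAddGroup.quotientKerEquivRange fm).toEquiv]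
  have hpos : 0 < Nat.card fm.ker := Nat.card_pos
  have hcard : Nat.card fp.ker ≤ Nat.card fm.range := by
    rw [h1] at hcp
    have : Nat.card fm.range * Nat.card fm.ker = Nat.card fp.ker * Nat.card fm.ker := by rw [← hcm, hcp, mul_comm]
    exact (Nat.eq_of_mul_eq_mul_right hpos this).ge
  have h3 : fm.range = fp.ker := AddSubgroup.eq_of_le_of_card_ge h2 hcard
  intro x hx
  have hx' : x ∈ fp.ker := by rw [AddMonoidHom.mem_ker, hfp_apply, hx, neg_add_cancel]
  rw [← h3] at hx'
  obtain ⟨y, hy⟩ := hx'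
  refine ⟨-y, ?_⟩
  rw [map_neg, ← hy, hfm_apply]; abel


/-- **Galois-level anti-lossless** (export for §K consumers): for `h₀ ∈ Γ_ℚ` acting as an involution on `E[m]` with the graded LOSSLESS clause
of §J/§K (`ker(h₀ - 1) = im(h₀ + 1)` on each `E[m][2^k]`), the graded ANTI-LOSSLESS clause holds: `ker(h₀ + 1) = im(h₀ - 1)` on each `E[m][2^k]`. -/
theorem antiLossless_geomTorsion [W.IsElliptic] {m : ℕ} [NeZero m] (h₀ : absoluteGaloisGroup ℚ)
    (hsq : ∀ P : geomTorsion W (m : ℤ), h₀ • h₀ • P = P)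
    (hker : ∀ (k : ℕ) (X : geomTorsion W (m : ℤ)), (2 : ℤ) ^ k • X = 0 → h₀ • X = X →
      ∃ Y : geomTorsion W (m : ℤ), (2 : ℤ) ^ k • Y = 0 ∧ X = Y + h₀ • Y)
    (k : ℕ) (X : geomTorsion W (m : ℤ)) (hk : (2 : ℤ) ^ k • X = 0) (hX : h₀ • X = -X) :
    ∃ Y : geomTorsion W (m : ℤ), (2 : ℤ) ^ k • Y = 0 ∧ X = Y - h₀ • Y := by
  have hm : ((m : ℕ) : ℤ) ≠ 0 := by exact_mod_cast NeZero.ne m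
  haveI : Finite (geomTorsion W (m : ℤ)) := finite_torsionPoints_holds W (AlgebraicClosure ℚ) hm
  -- the `2^k`-torsion subgroup `T_k ⊆ E[m]` and the restriction of `h₀` to it
  let Tk : AddSubgroup (geomTorsion W (m : ℤ)) := (zsmulAddGroupHom ((2 : ℤ) ^ k) : _ →+ _).ker
  have hmemTk : ∀ {Z : geomTorsion W (m : ℤ)}, Z ∈ Tk ↔ (2 : ℤ) ^ k • Z = 0 := fun {Z} ↦ by
    simp [Tk, AddMonoidHom.mem_ker]
  let φ : geomTorsion W (m : ℤ) →+ geomTorsion W (m : ℤ) := DistribMulAction.toAddMonoidHom _ h₀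
  have hφ : ∀ Z, φ Z = h₀ • Z := fun Z ↦ rfl
  have hφTk : ∀ Z : Tk, φ Z ∈ Tk := fun Z ↦ by
    rw [hmemTk, hφ, smul_comm, hmemTk.1 Z.2, smul_zero]
  let A : Tk →+ Tk := (φ.comp Tk.subtype).codRestrict Tk (fun Z ↦ hφTk Z)
  have hA_apply : ∀ Z : Tk, ((A Z : Tk) : geomTorsion W (m : ℤ)) = h₀ • (Z : geomTorsion W (m : ℤ)) := fun Z ↦ rfl
  have hA : ∀ Z, A (A Z) = Z := fun Z ↦ by
    apply Subtype.ext
    rw [hA_apply, hA_apply, hsq]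
  have hloss : ∀ Z, A Z = Z → ∃ Y, Z = Y + A Y := by
    intro Z hZ
    have hZ' : h₀ • (Z : geomTorsion W (m : ℤ)) = Z := by rw [← hA_apply, hZ]
    obtain ⟨Y, hY, hZY⟩ := hker k Z (hmemTk.1 Z.2) hZ'
    refine ⟨⟨Y, hmemTk.2 hY⟩, Subtype.ext ?_⟩
    simpa [hA_apply] using hZY
  obtain ⟨Y, hY⟩ := antiLossless_of_lossless A hA hloss ⟨X, hmemTk.2 hk⟩
    (Subtype.ext (by rw [hA_apply]; simpa using hX))
  refine ⟨Y, hmemTk.1 Y.2, ?_⟩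
  have := congrArg (fun Z : Tk ↦ (Z : geomTorsion W (m : ℤ))) hY
  simpa [hA_apply] using this

end AntiLosslessN

end Summit.BirchSwinnertonDyer.BirchSwinnertonDyer.Cruxes.RankOneAtTwoOffBigImageOddLocal.RefinedKolyvaginTamagawaShiftAtTwo.EngineG6

end
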